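import Literature.Computability.AlgebraicComplexity.MS21DiagonalTensorOrbitsHittingProofs
import Literature.Computability.AlgebraicComplexity.MS21CoordinateProjectionHitting
import HarnessLib

/-!
# Medini–Shpilka 2021, Thm 45 in EVERY characteristic: second-order HASSE derivatives separate the
# orbits `T_{s,d}^{GL_n}` (the characteristic-`p` residue of the printed proof, Case B)

Theorem file (cell `val-lit`, seat t18 g5; support brick for the registry fact
`Literature.Computability.AlgebraicComplexity.MS2021_thm_45`, holder seat x6 g3) for
[MediniShpilka2021, Thm 45 (CCC LIPIcs 200:19, p.19:14) = arXiv:2102.05632 ‹PITsumSDMinv›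
p0009:L9-L12; proof §6.2 p0036:L1-L52]:

> "Let `n, s₁, s₂, d₁, d₂ ∈ ℕ` be such that `n ≥ s₁d₁, s₂d₂`. For `i ∈ {1,2}` let
> `f_i ∈ T_{s_i,d_i}^{GL_n(F)}`, and let `f = f₁ - f₂`. If `f ≠ 0`, then any uniform `6`-independent
> `G` satisfies `f ∘ G ≠ 0`."

WHAT THIS FILE ADDS. Seat x6 g3's assembly `MS21DiagonalTensorOrbitsHittingProofs.lean` proves the
statement for fields in which `2, …, min(d₁,d₂)` are nonzero (`MS2021.thm_45_of_cast_ne_zero`); the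
ONLY characteristic-dependent step of the printed proof is Case B, sub-case "some `a_{i,j} ≥ 2`"
(p0036:L38-L42: "`∂²f₂/∂u∂w ≠ 0`, as the monomial exists in `f₂`" — the coefficient is
`a(a-1)·c`, zero when `char F ∣ a(a-1)`; registry item B35). Here the equal-span case
(p0036:L26-L50) is proved WITHOUT any characteristic hypothesis:
`MS2021.bind₁_sub_ne_zero_of_rows_eq` (x6's binder shape minus `hchar`, with the change of basis
`M` square). The two new ingredients, neither of which is in the source:

1. **Hasse derivatives.** `MS2021.taylorAlong u : f ↦ f(x + z·u) ∈ K[x][z]` and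
   `MS2021.hasseD k u f :=` its `z^k`-coefficient (so `hasseD 1 u = ∂/∂u`, Def 3.6, and
   `k!·hasseD k u = ∂^k/∂u^k`). The second Hasse derivative along a slot, `Δ²_{e_w}`, kills the
   multilinear tensor `T' = Σ_a ∏_j y_{a,j}` in every characteristic (`hasseD_two_single_sum_prod_X`)
   and sees `y_w² · m` with coefficient `C(2,2) = 1` (x6's char-`2` example `f = -x₁²` has
   `Δ²_u f = -ℓ₁(u)² ≠ 0`). ONE peeled `1`-independent block annihilates ALL Taylor coefficients
   along `c·e_i` (`bind₁_hasseD_single_eq_zero` — the printed Lemma 3.9 reads off `∂/∂z|_{z=0}`, we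
   read off every `z^k`-coefficient), so TWO peeled blocks annihilate every second-order Hasse
   operator along any direction (`bind₁_ne_zero_of_forall_hasseD_two`, via the characteristic-free
   polarisation identity `hasseD_two_add`: `Δ²_{u+v} = Δ²_u + Δ²_v + ∂_u∂_v`). Chain rules through
   affine substitutions come for free from `taylorAlong` being an algebra map
   (`hasseD_aeval_affine`, `dualHasseD_affSubst_rename`), and
   `Δ^k_v ∏_{j∈s} y_j = Σ_{J⊆s,|J|=k} ∏_J v ∏_{s∖J} y` (`hasseD_prod_X`) puts `Δ²_v T'` inside the class
   of polynomials that seat t18's Lemma 6.2 engine (`DiagDeriv.bind₁_affSubst_ne_zero_of_blockSupport`,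
   `k = 2`, four blocks) hits (`bind₁_affSubst_rename_hasseD_two_ne_zero`).
2. **Structure lemma** (`rowSupported_of_forall_hasseD_eq_zero`, `d ≥ 3`). Per monomial the Hasse
   test still fails when `char F ∣ C(a,2)`; the replacement is global: for `P = T' ∘ M` with `M`
   invertible, if `Δ²_{e_w} P = 0` for every slot `w` and `∂_w∂_{w'} P = 0` whenever
   `∂_w∂_{w'} T' = 0`, then — reading the coefficients `M_{aj,w} M_{aj',w}` and (after polarisation)
   `M_{aj,w} M_{aj',w'} + M_{aj',w} M_{aj,w'}` of `Δ²_{M e_w} T'`, `Δ²_{M(e_w+e_{w'})} T'` on the distinct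
   monomials `∏_{j''≠j,j'} y_{a,j''}` (`coeff_hasseD_sum_prod_X`) — the `d` rows `(a,·)` of `M` have
   pairwise disjoint singleton supports inside one column block, so `P` is a combination of row
   monomials of `T'`: the printed Case A. Hence Case B ALWAYS has a separating second-order operator
   (a slot Hasse derivative, or a printed mixed dual derivative), and `2 + 4 = 6` blocks suffice in
   every characteristic. (`d ≤ 6`, in particular `d = 2`, needs none of this: a nonzero form of
   degree `≤ 6` is hit by the support lemma of seat x5 g3,
   `MS2021.IsIndependent.bind₁_ne_zero_of_totalDegree_le`.)

Case A and the printed mixed-derivative branch of Case B are seat x6 g3's arguments verbatim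
(`pderiv_eq_C_mul_prod_of_rows`, `dualDeriv_affSubst_rename`, `coeff_sum_prod_X`,
`affSubst_rename_eq_of_rows_eq`, `bind₁_ne_zero_of_forall_dirDeriv(_dirDeriv)`,
`bind₁_dirDeriv_dirDeriv_ne_zero_of_mem_affOrbit_sdm`); the one-block peeling follows seat t24 g5's
`bind₁_sum_ne_zero_of_pderiv` (`MS21IndependentMapLemmas.lean`). The all-fields `_holds` assembly
(both-spans split `⊄ / ⊄ / =`, with the `⊄` cases by x6's `bind₁_sub_ne_zero_of_notMem_span` and the
`=` case by `bind₁_sub_ne_zero_of_rows_eq` after `card_eq_of_span_eq`) is the registry holder's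
(cell RULING (64)(b)); it is not in this file.

Definitions: `MS2021.taylorAlong`, `MS2021.hasseD` (plumbing, [folklore]: Hasse 1936 /
Hasse–Schmidt higher derivations; not notions of the source). No facts (D-0026). HONEST FRAMING: a
characteristic-free repair of one step of a 2021 published PIT proof; `VP ≠ VNP` is NOT proved and
nothing here bears on it.

## References
* [MediniShpilka2021] D. Medini, A. Shpilka, *Hitting sets and reconstruction for dense orbits in
  VP_e and ΣΠΣ circuits*, CCC 2021 (LIPIcs 200:19), Thm 45; arXiv:2102.05632, statement
  p0009:L9-L12, proof §6.2 p0036:L1-L52 (Case B p0036:L33-L50), Lemma 6.2 p0035, Lemma 3.8/3.9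
  p0017-p0018, Def 3.6 p0017:L44-L49.
* H. Hasse, *Theorie der höheren Differentiale in einem algebraischen Funktionenkörper mit
  vollkommenem Konstantenkörper bei beliebiger Charakteristik*, J. reine angew. Math. 175 (1936)
  — the divided-power ("Hasse") derivatives; folklore here.
-/

noncomputable section

open MvPolynomial Matrix

namespace Literature.Computability.AlgebraicComplexity

namespace MS2021

/-! ### Taylor shift along a direction and Hasse derivatives -/

section Taylor

variable {K : Type*} [CommRing K] {σ : Type*}

/-- **Taylor shift along a direction** `u ∈ K^σ`: the `K`-algebra map `f(x) ↦ f(x + z·u)` into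
`K[x][z]` (a fresh variable `z`). Its `z^k`-coefficients are the HASSE derivatives of `f` along `u`
(`hasseD`); over a field of characteristic `0`, `k! · hasseD k u f = ∂^k f/∂u^k`.
[folklore] (Hasse 1936 / Hasse–Schmidt derivations; used here to repair the characteristic-`p`
step of [cite: MediniShpilka2021, proof of Thm 45 (arXiv p0036:L38-L42)]) -/
def taylorAlong (u : σ → K) : MvPolynomial σ K →ₐ[K] Polynomial (MvPolynomial σ K) :=
  aeval fun i => Polynomial.C (X i) + Polynomial.C (C (u i)) * Polynomial.X

/-- **Hasse derivative of order `k` along `u`**: the coefficient of `z^k` in `f(x + z·u)`.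
[folklore] (Hasse derivatives; cf. [cite: MediniShpilka2021, Def 3.6 (arXiv p0017:L44-L49)] for `k = 1`) -/
def hasseD (k : ℕ) (u : σ → K) (f : MvPolynomial σ K) : MvPolynomial σ K :=
  (taylorAlong u f).coeff k

/-- Taylor shift of a variable: `x_i ↦ x_i + u_i z`. [cite: MediniShpilka2021, Def 3.6 (arXiv p0017:L44-L49)] -/
theorem taylorAlong_X (u : σ → K) (i : σ) :
    taylorAlong u (X i) = Polynomial.C (X i) + Polynomial.C (C (u i)) * Polynomial.X :=
  aeval_X _ _

/-- Taylor shift of a constant. [cite: MediniShpilka2021, Def 3.6 (arXiv p0017:L44-L49)] -/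
theorem taylorAlong_C (u : σ → K) (a : K) :
    taylorAlong u (C a) = Polynomial.C (C a) := by
  rw [taylorAlong, algHom_C, Polynomial.algebraMap_apply, algebraMap_eq]

/-- `z^{k+1}`-coefficient of `q · (a + b z)`. [folklore] -/
private theorem coeff_mul_linear_succ (q : Polynomial (MvPolynomial σ K)) (a b : MvPolynomial σ K)
    (k : ℕ) : (q * (Polynomial.C a + Polynomial.C b * Polynomial.X)).coeff (k + 1) =
      q.coeff (k + 1) * a + q.coeff k * b := by
  rw [mul_add, Polynomial.coeff_add, Polynomial.coeff_mul_C, ← mul_assoc, Polynomial.coeff_mul_X,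
    Polynomial.coeff_mul_C]

/-- constant coefficient of `q · (a + b z)`. [folklore] -/
private theorem coeff_mul_linear_zero (q : Polynomial (MvPolynomial σ K)) (a b : MvPolynomial σ K) :
    (q * (Polynomial.C a + Polynomial.C b * Polynomial.X)).coeff 0 = q.coeff 0 * a := by
  rw [mul_add, Polynomial.coeff_add, Polynomial.coeff_mul_C, ← mul_assoc, Polynomial.mul_coeff_zero,
    Polynomial.coeff_X_zero, mul_zero, add_zero]

/-- Hasse derivatives are additive (linearity of `∂/∂v`, Def 3.6, all orders). [cite: MediniShpilka2021, Def 3.6 (arXiv p0017:L44-L49)] -/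
theorem hasseD_add (k : ℕ) (u : σ → K) (f g : MvPolynomial σ K) :
    hasseD k u (f + g) = hasseD k u f + hasseD k u g := by
  rw [hasseD, map_add, Polynomial.coeff_add]; rfl

/-- Hasse derivatives respect subtraction. [cite: MediniShpilka2021, Def 3.6 (arXiv p0017:L44-L49)] -/
theorem hasseD_sub (k : ℕ) (u : σ → K) (f g : MvPolynomial σ K) :
    hasseD k u (f - g) = hasseD k u f - hasseD k u g := by
  rw [hasseD, map_sub, Polynomial.coeff_sub]; rfl

/-- Hasse derivatives of `0`. [cite: MediniShpilka2021, Def 3.6 (arXiv p0017:L44-L49)] -/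
theorem hasseD_zero_right (k : ℕ) (u : σ → K) : hasseD k u (0 : MvPolynomial σ K) = 0 := by
  rw [hasseD, map_zero, Polynomial.coeff_zero]

/-- Hasse derivatives are `K`-linear. [cite: MediniShpilka2021, Def 3.6 (arXiv p0017:L44-L49)] -/
theorem hasseD_C_mul (k : ℕ) (u : σ → K) (a : K) (f : MvPolynomial σ K) :
    hasseD k u (C a * f) = C a * hasseD k u f := by
  rw [hasseD, map_mul, taylorAlong_C, Polynomial.coeff_C_mul]; rfl

/-- Hasse derivatives of a finite sum. [cite: MediniShpilka2021, Def 3.6 (arXiv p0017:L44-L49)] -/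
theorem hasseD_sum (k : ℕ) (u : σ → K) {ι : Type*} (s : Finset ι) (f : ι → MvPolynomial σ K) :
    hasseD k u (∑ i ∈ s, f i) = ∑ i ∈ s, hasseD k u (f i) := by
  rw [hasseD, map_sum, Polynomial.finsetSum_coeff]; rfl

/-- `z`-constant term: `f(x + 0·u) = f`. [cite: MediniShpilka2021, Def 3.6 (arXiv p0017:L44-L49)] -/
theorem hasseD_zero (u : σ → K) (f : MvPolynomial σ K) : hasseD 0 u f = f := by
  induction f using MvPolynomial.induction_on with
  | C a => rw [hasseD, taylorAlong_C, Polynomial.coeff_C_zero]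
  | add p q hp hq => rw [hasseD_add, hp, hq]
  | mul_X p i hp =>
    rw [hasseD, map_mul, taylorAlong_X, coeff_mul_linear_zero]
    exact congrArg (· * X i) hp

/-- Along the zero direction the Taylor shift is constant in `z`. [cite: MediniShpilka2021, Def 3.6 (arXiv p0017:L44-L49)] -/
theorem taylorAlong_zero (f : MvPolynomial σ K) :
    taylorAlong (0 : σ → K) f = Polynomial.C f := by
  induction f using MvPolynomial.induction_on with
  | C a => rw [taylorAlong_C]
  | add p q hp hq => rw [map_add, hp, hq, Polynomial.C_add]
  | mul_X p i hp =>
    rw [map_mul, hp, taylorAlong_X, Pi.zero_apply, C_0, Polynomial.C_0, zero_mul, add_zero,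
      Polynomial.C_mul]

/-- Along the zero direction all higher Taylor coefficients vanish. [cite: MediniShpilka2021, Def 3.6 (arXiv p0017:L44-L49)] -/
theorem hasseD_dir_zero (k : ℕ) (hk : k ≠ 0) (f : MvPolynomial σ K) :
    hasseD k (0 : σ → K) f = 0 := by
  rw [hasseD, taylorAlong_zero, Polynomial.coeff_C, if_neg hk]

variable [Fintype σ] [DecidableEq σ]

/-- **First order: the Hasse derivative of order `1` is the directional derivative**
`∂f/∂u = Σ_i u_i ∂f/∂x_i` (Def 3.6). [cite: MediniShpilka2021, Def 3.6 (arXiv p0017:L44-L49)] -/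
theorem hasseD_one (u : σ → K) (f : MvPolynomial σ K) :
    hasseD 1 u f = ∑ i, C (u i) * pderiv i f := by
  induction f using MvPolynomial.induction_on with
  | C a =>
    rw [hasseD, taylorAlong_C, Polynomial.coeff_C, if_neg one_ne_zero]
    exact (Finset.sum_eq_zero fun i _ => by rw [pderiv_C, mul_zero]).symm
  | add p q hp hq =>
    rw [hasseD_add, hp, hq, ← Finset.sum_add_distrib]
    exact Finset.sum_congr rfl fun i _ => by rw [map_add, mul_add]
  | mul_X p i hp =>
    rw [hasseD, map_mul, taylorAlong_X, coeff_mul_linear_succ]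
    change hasseD 1 u p * X i + hasseD 0 u p * C (u i) = _
    rw [hp, hasseD_zero]
    simp_rw [Derivation.leibniz, pderiv_X, smul_eq_mul, mul_add, Finset.sum_add_distrib]
    rw [add_comm]
    congr 1
    · rw [Finset.sum_eq_single i (fun j _ hj => by
          rw [Pi.single_eq_of_ne (Ne.symm hj), mul_zero, mul_zero])
        (fun h => absurd (Finset.mem_univ i) h), Pi.single_eq_same, mul_one, mul_comm]
    · rw [Finset.sum_mul]
      exact Finset.sum_congr rfl fun j _ => by ring

/-- `∂f/∂(u+v) = ∂f/∂u + ∂f/∂v` (Def 3.6 is linear in the direction). [cite: MediniShpilka2021, Def 3.6 (arXiv p0017:L44-L49)] -/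
theorem hasseD_one_add_dir (u v : σ → K) (f : MvPolynomial σ K) :
    hasseD 1 (u + v) f = hasseD 1 u f + hasseD 1 v f := by
  rw [hasseD_one, hasseD_one, hasseD_one, ← Finset.sum_add_distrib]
  exact Finset.sum_congr rfl fun i _ => by rw [Pi.add_apply, C_add, add_mul]

/-- **Polarisation of the second Hasse derivative**:
`Δ²_{u+v} f = Δ²_u f + Δ²_v f + Σ_{a,b} u_a v_b ∂²f/∂x_a∂x_b` (valid in every characteristic; over
`ℚ` it is `½(∂_u+∂_v)² = ½∂_u² + ½∂_v² + ∂_u∂_v`); the second-order companion of the linearity of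
Def 3.6 in the direction. [cite: MediniShpilka2021, Def 3.6 (arXiv p0017:L44-L49)] -/
theorem hasseD_two_add (u v : σ → K) (f : MvPolynomial σ K) :
    hasseD 2 (u + v) f = hasseD 2 u f + hasseD 2 v f +
      ∑ a, ∑ b, C (u a * v b) * pderiv a (pderiv b f) := by
  induction f using MvPolynomial.induction_on with
  | C c =>
    simp only [hasseD, taylorAlong_C, Polynomial.coeff_C, if_neg (two_ne_zero), pderiv_C, map_zero,
      mul_zero, Finset.sum_const_zero, add_zero]
  | add p q hp hq =>
    rw [hasseD_add, hasseD_add, hasseD_add, hp, hq]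
    simp only [map_add, mul_add, Finset.sum_add_distrib]
    ring
  | mul_X p i hp =>
    have key : ∀ w : σ → K, hasseD 2 w (p * X i) = hasseD 2 w p * X i + hasseD 1 w p * C (w i) := by
      intro w
      rw [hasseD, map_mul, taylorAlong_X, coeff_mul_linear_succ]
      rfl
    rw [key, key, key, hp, hasseD_one_add_dir]
    -- second derivatives of `p * X i`
    have h2 : ∀ a b : σ, pderiv a (pderiv b (p * X i)) =
        pderiv a (pderiv b p) * X i + pderiv b p * Pi.single (M := fun _ => MvPolynomial σ K) a 1 i +
          pderiv a p * Pi.single (M := fun _ => MvPolynomial σ K) b 1 i := by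
      intro a b
      have hz : pderiv a (Pi.single (M := fun _ => MvPolynomial σ K) b 1 i) = 0 := by
        by_cases h : i = b
        · subst h; rw [Pi.single_eq_same, pderiv_one]
        · rw [Pi.single_eq_of_ne h, map_zero]
      simp only [Derivation.leibniz, pderiv_X, smul_eq_mul, map_add, hz]
      ring
    simp_rw [h2, mul_add, Finset.sum_add_distrib]
    have hS0 : ∑ a, ∑ b, C (u a * v b) * (pderiv a (pderiv b p) * X i) =
        (∑ a, ∑ b, C (u a * v b) * pderiv a (pderiv b p)) * X i := by
      rw [Finset.sum_mul]
      refine Finset.sum_congr rfl fun a _ => ?_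
      rw [Finset.sum_mul]
      exact Finset.sum_congr rfl fun b _ => by rw [mul_assoc]
    have hS1 : ∑ a, ∑ b, C (u a * v b) *
        (pderiv b p * Pi.single (M := fun _ => MvPolynomial σ K) a 1 i) =
        C (u i) * hasseD 1 v p := by
      rw [Finset.sum_eq_single i (fun a _ ha => Finset.sum_eq_zero fun b _ => by
          rw [Pi.single_eq_of_ne (Ne.symm ha), mul_zero, mul_zero])
          (fun h => absurd (Finset.mem_univ i) h),
        Pi.single_eq_same, hasseD_one, Finset.mul_sum]
      exact Finset.sum_congr rfl fun b _ => by rw [map_mul]; ring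
    have hS2 : ∑ a, ∑ b, C (u a * v b) *
        (pderiv a p * Pi.single (M := fun _ => MvPolynomial σ K) b 1 i) =
        C (v i) * hasseD 1 u p := by
      rw [hasseD_one, Finset.mul_sum]
      refine Finset.sum_congr rfl fun a _ => ?_
      rw [Finset.sum_eq_single i (fun b _ hb => by
          rw [Pi.single_eq_of_ne (Ne.symm hb), mul_zero, mul_zero])
        (fun h => absurd (Finset.mem_univ i) h), Pi.single_eq_same, map_mul]
      ring
    rw [hS0, hS1, hS2, Pi.add_apply, C_add]
    ring

end Taylor

/-! ### Chain rules: Hasse derivatives through affine substitutions -/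

section Chain

variable {K : Type*} [CommRing K] {σ τ : Type*} [Fintype σ]

/-- Taylor shift of an affine-linear polynomial (`ℓ(x + zu) = ℓ(x) + z·ℓ_lin(u)`).
[cite: MediniShpilka2021, Lemma 3.8 (arXiv p0017:L61-L68)] -/
theorem taylorAlong_affine (u a : σ → K) (b : K) :
    taylorAlong u ((∑ i, C (a i) * X i) + C b) =
      Polynomial.C ((∑ i, C (a i) * X i) + C b) +
        Polynomial.C (C (∑ i, a i * u i)) * Polynomial.X := by
  rw [map_add, taylorAlong_C, map_sum]
  simp_rw [map_mul, taylorAlong_C, taylorAlong_X]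
  have h : ∀ i, Polynomial.C (C (a i)) * (Polynomial.C (X i) + Polynomial.C (C (u i)) * Polynomial.X) =
      Polynomial.C (C (a i) * X i) + Polynomial.C (C (a i * u i)) * Polynomial.X := by
    intro i
    rw [mul_add, ← mul_assoc, ← Polynomial.C_mul, ← Polynomial.C_mul, ← C_mul]
  simp_rw [h]
  rw [Finset.sum_add_distrib, ← Finset.sum_mul, ← map_sum Polynomial.C, ← map_sum Polynomial.C,
    ← map_sum C, Polynomial.C_add]
  ring

/-- **Chain rule through an affine substitution** `x_j ↦ g_j = Σ_i A_{j,i} y_i + b_j`: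
`(f ∘ g)(y + z·u) = f(g(y) + z·(A u))`, i.e. the Taylor shift of `f ∘ g` along `u` is the image of
the Taylor shift of `f` along `A u` (the printed `∂(f(Ax+b))/∂v = Σ_i (Av)_i (∂f/∂x_i)(Ax+b)`, all
orders at once). [cite: MediniShpilka2021, Lemma 3.8 (arXiv p0017:L61-L68)] -/
theorem taylorAlong_aeval_affine (g : τ → MvPolynomial σ K) (A : τ → σ → K) (b : τ → K)
    (hg : ∀ j, g j = (∑ i, C (A j i) * X i) + C (b j)) (u : σ → K) (f : MvPolynomial τ K) :
    taylorAlong u (aeval g f) =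
      Polynomial.map (aeval g : MvPolynomial τ K →ₐ[K] MvPolynomial σ K)
        (taylorAlong (fun j => ∑ i, A j i * u i) f) := by
  change ((taylorAlong u).comp (aeval g)) f =
    ((Polynomial.mapAlgHom (aeval g)).comp (taylorAlong fun j => ∑ i, A j i * u i)) f
  congr 1
  refine MvPolynomial.algHom_ext fun j => ?_
  rw [AlgHom.comp_apply, aeval_X, hg, taylorAlong_affine, AlgHom.comp_apply, taylorAlong_X,
    Polynomial.coe_mapAlgHom, Polynomial.map_add, Polynomial.map_mul, Polynomial.map_C,
    Polynomial.map_C, Polynomial.map_X, RingHom.coe_coe, aeval_X, algHom_C, algebraMap_eq, hg]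

/-- Hasse derivatives through an affine substitution (coefficientwise form of
`taylorAlong_aeval_affine`). [cite: MediniShpilka2021, Lemma 3.8 (arXiv p0017:L61-L68)] -/
theorem hasseD_aeval_affine (g : τ → MvPolynomial σ K) (A : τ → σ → K) (b : τ → K)
    (hg : ∀ j, g j = (∑ i, C (A j i) * X i) + C (b j)) (k : ℕ) (u : σ → K)
    (f : MvPolynomial τ K) :
    hasseD k u (aeval g f) = aeval g (hasseD k (fun j => ∑ i, A j i * u i) f) := by
  rw [hasseD, taylorAlong_aeval_affine g A b hg, Polynomial.coeff_map, RingHom.coe_coe]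
  rfl

omit [Fintype σ] in
/-- Taylor shift through a renaming of variables. [cite: MediniShpilka2021, Def 3.6 (arXiv p0017:L44-L49)] -/
theorem taylorAlong_rename {ι : Type*} (e : ι → σ) (u : σ → K) (f : MvPolynomial ι K) :
    taylorAlong u (rename e f) =
      Polynomial.map (rename e : MvPolynomial ι K →ₐ[K] MvPolynomial σ K)
        (taylorAlong (u ∘ e) f) := by
  change ((taylorAlong u).comp (rename e)) f =
    ((Polynomial.mapAlgHom (rename e)).comp (taylorAlong (u ∘ e))) f
  congr 1
  refine MvPolynomial.algHom_ext fun j => ?_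
  rw [AlgHom.comp_apply, rename_X, taylorAlong_X, AlgHom.comp_apply, taylorAlong_X,
    Polynomial.coe_mapAlgHom, Polynomial.map_add, Polynomial.map_mul, Polynomial.map_C,
    Polynomial.map_C, Polynomial.map_X, RingHom.coe_coe, rename_X, rename_C, Function.comp_apply]

omit [Fintype σ] in
/-- Hasse derivatives through a renaming of variables. [cite: MediniShpilka2021, Def 3.6 (arXiv p0017:L44-L49)] -/
theorem hasseD_rename {ι : Type*} (e : ι → σ) (k : ℕ) (u : σ → K) (f : MvPolynomial ι K) :
    hasseD k u (rename e f) = rename e (hasseD k (u ∘ e) f) := by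
  rw [hasseD, taylorAlong_rename, Polynomial.coeff_map, RingHom.coe_coe]
  rfl

end Chain

/-! ### Peeling one `1`-independent block: ALL Taylor coefficients vanish -/

section Peel

variable {K : Type*} [CommRing K] {n t : ℕ}

/-- `aeval (C ∘ X) = C` into `K[x][z]`. [folklore] -/
private theorem aeval_polynomialC_X {τ : Type*} (p : MvPolynomial τ K) :
    aeval (fun w => (Polynomial.C (X w) : Polynomial (MvPolynomial τ K))) p = Polynomial.C p := by
  induction p using MvPolynomial.induction_on with
  | C a => rw [algHom_C, Polynomial.algebraMap_apply, algebraMap_eq]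
  | add p q hp hq => rw [map_add, hp, hq, Polynomial.C_add]
  | mul_X p i hp => rw [map_mul, hp, aeval_X, Polynomial.C_mul]

/-- **Hasse form of Lemma 3.9 (`k = 1`)**: if `f ∘ (G_1 + H) = 0` for a `1`-independent `G_1(y, z)`
and ANY map `H` in disjoint variables, then substituting `y := α_i`, `z := c·z` gives
`f(H + c z·e_i) = 0` in `K[w][z]`, i.e. EVERY Taylor coefficient of `f` along `c·e_i` vanishes on
`H`: `(hasseD k (c·e_i) f) ∘ H = 0` for all `k` (the printed lemma is the case `k = 1`, read off by
`∂/∂z` at `z = 0`; reading off the `z^k`-coefficient instead needs no division by `k!`).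
[cite: MediniShpilka2021, Lemma 3.9 (arXiv p0017:L70-L73, proof p0018:L1-L13)] -/
theorem map_bind₁_taylorAlong_eq_zero {τ : Type*} {G₁ : Fin n → MvPolynomial (Fin t ⊕ Unit) K}
    (hG₁ : IsOneIndependent G₁) (H : Fin n → MvPolynomial τ K) (f : MvPolynomial (Fin n) K)
    (i : Fin n) (c : K)
    (h0 : bind₁ (fun j => rename Sum.inl (G₁ j) + rename Sum.inr (H j)) f = 0) :
    Polynomial.map (bind₁ H : MvPolynomial (Fin n) K →+* MvPolynomial τ K)
      (taylorAlong (Pi.single i c) f) = 0 := by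
  classical
  obtain ⟨a, ha⟩ := hG₁ i
  -- the substitution `y := α_i`, `z := c z`, `w := w` into `K[w][z]`
  obtain ⟨Ψ, hΨ⟩ : ∃ Ψ : MvPolynomial ((Fin t ⊕ Unit) ⊕ τ) K →ₐ[K] Polynomial (MvPolynomial τ K),
      Ψ = aeval (Sum.elim (Sum.elim (fun s => Polynomial.C (C (a s)))
        (fun _ => Polynomial.C (C c) * Polynomial.X)) (fun w => Polynomial.C (X w))) := ⟨_, rfl⟩
  have h1 : ∀ j, Ψ (rename Sum.inl (G₁ j)) =
      if j = i then Polynomial.C (C c) * Polynomial.X else 0 := by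
    intro j
    rw [hΨ, aeval_rename, Sum.elim_comp_inl]
    have hfun : (Sum.elim (fun s => Polynomial.C (C (a s)))
        (fun _ => Polynomial.C (C c) * Polynomial.X) :
        Fin t ⊕ Unit → Polynomial (MvPolynomial τ K)) =
        fun v => aeval (fun _ : Unit =>
          (Polynomial.C (C c) * Polynomial.X : Polynomial (MvPolynomial τ K)))
          (Sum.elim (fun s => C (a s)) (fun _ => X ()) v) := by
      funext v
      rcases v with s | u
      · simp only [Sum.elim_inl, algHom_C, Polynomial.algebraMap_apply, algebraMap_eq]
      · simp only [Sum.elim_inr, aeval_X]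
    rw [hfun, ← comp_aeval, AlgHom.comp_apply, ha j]
    split_ifs
    · rw [aeval_X]
    · rw [map_zero]
  have h2 : ∀ j, Ψ (rename Sum.inr (H j)) = Polynomial.C (H j) := by
    intro j
    rw [hΨ, aeval_rename, Sum.elim_comp_inr, aeval_polynomialC_X]
  -- `Ψ (f ∘ (G_1 + H)) = f(H + c z e_i)`, which is the mapped Taylor shift
  have hcomp : Ψ (bind₁ (fun j => rename Sum.inl (G₁ j) + rename Sum.inr (H j)) f) =
      Polynomial.map (bind₁ H : MvPolynomial (Fin n) K →+* MvPolynomial τ K)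
        (taylorAlong (Pi.single i c) f) := by
    rw [← AlgHom.comp_apply, bind₁, comp_aeval]
    change _ = ((Polynomial.mapAlgHom (bind₁ H)).comp (taylorAlong (Pi.single i c))) f
    congr 1
    refine MvPolynomial.algHom_ext fun j => ?_
    rw [aeval_X, map_add, h1, h2, AlgHom.comp_apply, taylorAlong_X, Polynomial.coe_mapAlgHom,
      Polynomial.map_add, Polynomial.map_mul, Polynomial.map_C, Polynomial.map_C, Polynomial.map_X,
      RingHom.coe_coe, bind₁_X_right, bind₁_C_right]
    by_cases hji : j = i
    · subst hji
      rw [if_pos rfl, Pi.single_eq_same, add_comm]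
    · rw [if_neg hji, Pi.single_eq_of_ne hji, C_0, Polynomial.C_0, zero_mul, add_zero, zero_add]
  rw [← hcomp, h0, map_zero]

/-- Coefficientwise: every Hasse derivative of `f` along `c·e_i` vanishes on `H`.
[cite: MediniShpilka2021, Lemma 3.9 (arXiv p0017:L70-L73, p0018:L1-L13)] -/
theorem bind₁_hasseD_single_eq_zero {τ : Type*} {G₁ : Fin n → MvPolynomial (Fin t ⊕ Unit) K}
    (hG₁ : IsOneIndependent G₁) (H : Fin n → MvPolynomial τ K) (f : MvPolynomial (Fin n) K)
    (i : Fin n) (c : K) (k : ℕ)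
    (h0 : bind₁ (fun j => rename Sum.inl (G₁ j) + rename Sum.inr (H j)) f = 0) :
    bind₁ H (hasseD k (Pi.single i c) f) = 0 := by
  classical
  have e := congrArg (fun q => Polynomial.coeff q k) (map_bind₁_taylorAlong_eq_zero hG₁ H f i c h0)
  simp only [Polynomial.coeff_map, RingHom.coe_coe, Polynomial.coeff_zero] at e
  exact e

/-- **Killing a block**: `f ∘ (G_1 + H) = 0 ⇒ f ∘ H = 0` (substitute `y := α_{i₀}`, `z := 0`, so that
`G_1 ↦ 0`). [cite: MediniShpilka2021, Obs 3.1 (2) (arXiv p0017:L7-L9)] -/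
theorem bind₁_eq_zero_of_bind₁_sum_eq_zero {τ : Type*} {G₁ : Fin n → MvPolynomial (Fin t ⊕ Unit) K}
    (hG₁ : IsOneIndependent G₁) (i₀ : Fin n) (H : Fin n → MvPolynomial τ K)
    (f : MvPolynomial (Fin n) K)
    (h0 : bind₁ (fun j => rename Sum.inl (G₁ j) + rename Sum.inr (H j)) f = 0) :
    bind₁ H f = 0 := by
  classical
  obtain ⟨a, ha⟩ := hG₁ i₀
  obtain ⟨Ψ, hΨ⟩ : ∃ Ψ : MvPolynomial ((Fin t ⊕ Unit) ⊕ τ) K →ₐ[K] MvPolynomial τ K,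
      Ψ = aeval (Sum.elim (Sum.elim (fun s => C (a s)) (fun _ => 0)) X) := ⟨_, rfl⟩
  have h1 : ∀ j, Ψ (rename Sum.inl (G₁ j)) = 0 := by
    intro j
    rw [hΨ, aeval_rename, Sum.elim_comp_inl]
    have hfun : (Sum.elim (fun s => C (a s)) (fun _ => 0) : Fin t ⊕ Unit → MvPolynomial τ K) =
        fun v => aeval (fun _ : Unit => (0 : MvPolynomial τ K))
          (Sum.elim (fun s => C (a s)) (fun _ => X ()) v) := by
      funext v
      rcases v with s | u
      · simp only [Sum.elim_inl, algHom_C, algebraMap_eq]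
      · simp only [Sum.elim_inr, aeval_X]
    rw [hfun, ← comp_aeval, AlgHom.comp_apply, ha j]
    split_ifs
    · rw [aeval_X]
    · rw [map_zero]
  have h2 : ∀ j, Ψ (rename Sum.inr (H j)) = H j := by
    intro j
    rw [hΨ, aeval_rename, Sum.elim_comp_inr, aeval_X_left, AlgHom.id_apply]
  have hcomp : Ψ (bind₁ (fun j => rename Sum.inl (G₁ j) + rename Sum.inr (H j)) f) = bind₁ H f := by
    rw [← AlgHom.comp_apply, bind₁, comp_aeval, bind₁]
    have hfun : (fun j => Ψ (rename Sum.inl (G₁ j) + rename Sum.inr (H j))) = H := by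
      funext j
      rw [map_add, h1, h2, zero_add]
    rw [hfun]
  rw [← hcomp, h0, map_zero]

/-- Transport of vanishing from the product to the sum presentation of a peeled map.
[cite: MediniShpilka2021, Obs 3.1 (1) (arXiv p0017:L7-L8)] -/
theorem bind₁_sum_eq_zero_of_peel {k : ℕ} {G₁ : Fin n → MvPolynomial (Fin t ⊕ Unit) K}
    {G' : Fin n → MvPolynomial (Fin k × (Fin t ⊕ Unit)) K}
    {G : Fin n → MvPolynomial (Fin (k + 1) × (Fin t ⊕ Unit)) K}
    (hGeq : ∀ j, G j = rename (Prod.mk 0) (G₁ j) + rename (Prod.map Fin.succ id) (G' j))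
    (f : MvPolynomial (Fin n) K) (h0 : bind₁ G f = 0) :
    bind₁ (fun j => rename Sum.inl (G₁ j) + rename Sum.inr (G' j)) f = 0 := by
  have hG : G = fun j => rename (Prod.mk 0) (G₁ j) + rename (Prod.map Fin.succ id) (G' j) :=
    funext hGeq
  rw [hG, bind₁_peel_eq_rename] at h0
  exact (rename_injective _ sumElim_prodMk_injective) (by rw [map_zero]; exact h0)

/-- **Two peeled blocks give every second Hasse derivative** (the printed "by Lemma 3.9, any uniform
`6`-independent map hits `f`" with `∂²f/∂u∂w` replaced by `Δ²_u f`): to show that a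
`(k+2)`-independent map hits `f` it suffices that every `k`-independent map hits `hasseD 2 u f` for
one direction `u`. Proof: if `f ∘ G = 0`, peel `G = G_1 + G_2 + G''`; block `1` gives
`(Δ²_{c e_i} f) ∘ (G_2 + G'') = 0` and `(∂_{i'} f) ∘ (G_2 + G'') = 0`, block `2` then gives
`(Δ²_{c e_i} f) ∘ G'' = 0` and `(∂_i ∂_{i'} f) ∘ G'' = 0`, and polarisation (`hasseD_two_add`,
one coordinate at a time) finishes.
[cite: MediniShpilka2021, Lemma 3.9 and proof of Thm 45 (arXiv p0018:L1-L13, p0036:L50)] -/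
theorem bind₁_ne_zero_of_forall_hasseD_two {k c : ℕ}
    {G : Fin n → MvPolynomial (Fin (k + 2) × (Fin c ⊕ Unit)) K} (hG : IsIndependent (k + 2) G)
    (f : MvPolynomial (Fin n) K) (u : Fin n → K)
    (h : ∀ G'' : Fin n → MvPolynomial (Fin k × (Fin c ⊕ Unit)) K, IsIndependent k G'' →
      bind₁ G'' (hasseD 2 u f) ≠ 0) :
    bind₁ G f ≠ 0 := by
  classical
  intro h0
  obtain ⟨G₁, G', hG₁, hG', hGeq⟩ := isIndependent_succ_iff.1 hG
  have h0' := bind₁_sum_eq_zero_of_peel hGeq f h0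
  obtain ⟨G₂, G'', hG₂, hG'', hG'eq⟩ := isIndependent_succ_iff.1 hG'
  -- pure second Hasse derivatives along `a e_i` and mixed second derivatives vanish on `G''`
  have hpure : ∀ (i : Fin n) (a : K), bind₁ G'' (hasseD 2 (Pi.single i a) f) = 0 := by
    intro i a
    have h1 : bind₁ G' (hasseD 2 (Pi.single i a) f) = 0 :=
      bind₁_hasseD_single_eq_zero hG₁ G' f i a 2 h0'
    exact bind₁_eq_zero_of_bind₁_sum_eq_zero hG₂ i G'' _ (bind₁_sum_eq_zero_of_peel hG'eq _ h1)
  have hmixed : ∀ i i' : Fin n, bind₁ G'' (pderiv i (pderiv i' f)) = 0 := by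
    intro i i'
    have h1 : bind₁ G' (pderiv i' f) = 0 := by
      by_contra hne
      exact bind₁_sum_ne_zero_of_pderiv hG₁ G' f i' hne h0'
    by_contra hne
    exact bind₁_sum_ne_zero_of_pderiv hG₂ G'' (pderiv i' f) i hne (bind₁_sum_eq_zero_of_peel hG'eq _ h1)
  -- polarisation, one coordinate at a time
  have hpol : ∀ s : Finset (Fin n),
      bind₁ G'' (hasseD 2 (∑ i ∈ s, Pi.single i (u i)) f) = 0 := by
    intro s
    induction s using Finset.induction_on with
    | empty => rw [Finset.sum_empty, hasseD_dir_zero 2 two_ne_zero, map_zero]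
    | insert i s hi ih =>
      rw [Finset.sum_insert hi, hasseD_two_add, map_add, map_add, ih, hpure, zero_add, zero_add,
        map_sum]
      refine Finset.sum_eq_zero fun a _ => ?_
      rw [map_sum]
      refine Finset.sum_eq_zero fun b _ => ?_
      rw [map_mul, hmixed, mul_zero]
  apply h G'' hG''
  have hu : (∑ i ∈ Finset.univ, Pi.single i (u i) : Fin n → K) = u := Finset.univ_sum_single u
  rw [← hu]
  exact hpol Finset.univ

end Peel

/-! ### Taylor coefficients of a product of variables -/

section ProductFormula

variable {K : Type*} [CommRing K] {σ : Type*}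

/-- `z^k`-coefficient of `∏_{j ∈ s} (q_j z + p_j)`: the sum over `k`-subsets `J ⊆ s` of
`∏_{J} q · ∏_{s \ J} p` (elementary symmetric expansion; the shape of the iterated derivatives of a
product of linear forms in Lemma 6.2). [cite: MediniShpilka2021, Lemma 6.2 (arXiv p0035:L8-L30)] -/
theorem coeff_prod_linear {R ι : Type*} [CommRing R] [DecidableEq ι] (s : Finset ι) (p q : ι → R)
    (k : ℕ) : (∏ j ∈ s, (Polynomial.C (p j) + Polynomial.C (q j) * Polynomial.X)).coeff k =
      ∑ J ∈ s.powersetCard k, (∏ j ∈ J, q j) * ∏ j ∈ s \ J, p j := by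
  have hprod : (∏ j ∈ s, (Polynomial.C (p j) + Polynomial.C (q j) * Polynomial.X)) =
      ∑ J ∈ s.powerset, Polynomial.C ((∏ j ∈ J, q j) * ∏ j ∈ s \ J, p j) *
        Polynomial.X ^ J.card := by
    simp_rw [add_comm (Polynomial.C (p _)), Finset.prod_add, Finset.prod_mul_distrib,
      Finset.prod_const, ← map_prod Polynomial.C, Polynomial.C_mul]
    refine Finset.sum_congr rfl fun J _ => by ring
  rw [hprod, Polynomial.finsetSum_coeff]
  simp_rw [Polynomial.coeff_C_mul_X_pow]
  rw [Finset.powersetCard_eq_filter, Finset.sum_filter]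
  refine Finset.sum_congr rfl fun J _ => ?_
  by_cases hJ : J.card = k
  · rw [if_pos hJ.symm, if_pos hJ]
  · rw [if_neg (Ne.symm hJ), if_neg hJ]

/-- **Hasse derivatives of a product of distinct variables**: `Δ^k_u (∏_{j∈s} x_{g j}) =
Σ_{J ⊆ s, |J| = k} (∏_{j∈J} u_{g j}) ∏_{j ∈ s \ J} x_{g j}` — for `k = 1` this is
"`∂(∏ x)/∂u = Σ_j u_j ∏_{j' ≠ j} x_{j'}`", for `k = 2` the analogue with pairs.
[cite: MediniShpilka2021, §6.2, derivatives of `T_{s,d}` (arXiv p0035:L8-L14)] -/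
theorem hasseD_prod_X {ι : Type*} [DecidableEq ι] (k : ℕ) (u : σ → K) (s : Finset ι) (g : ι → σ) :
    hasseD k u (∏ j ∈ s, X (g j)) =
      ∑ J ∈ s.powersetCard k, C (∏ j ∈ J, u (g j)) * ∏ j ∈ s \ J, X (g j) := by
  rw [hasseD, map_prod]
  simp_rw [taylorAlong_X]
  rw [coeff_prod_linear]
  simp_rw [map_prod C]

end ProductFormula

/-! ### Linear substitutions `y ↦ M y` upstairs: chain rule and injectivity -/

section LinSubst

variable {K : Type*} [Field K] {σ : Type*} [Fintype σ] [DecidableEq σ]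

/-- Along a coordinate direction the first Hasse derivative is the partial derivative
("if `v = e_i`, we get the standard definition of partial derivative according to a variable"). [cite: MediniShpilka2021, Def 3.6 (arXiv p0017:L44-L49)] -/
theorem hasseD_one_single (w : σ) (f : MvPolynomial σ K) :
    hasseD 1 (Pi.single w 1) f = pderiv w f := by
  rw [hasseD_one, Finset.sum_eq_single w (fun i _ hi => by
      rw [Pi.single_eq_of_ne hi, C_0, zero_mul]) (fun h => absurd (Finset.mem_univ w) h),
    Pi.single_eq_same, C_1, one_mul]

omit [DecidableEq σ] in
/-- Chain rule for Hasse derivatives through `y ↦ M y` ("`f₂ = P(ℓ_1)` with `P = T' ∘ M`": the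
derivative of `q ∘ M` along `u` is the derivative of `q` along `M u`, composed with `M`).
[cite: MediniShpilka2021, Lemma 3.8 and proof of Thm 45 (arXiv p0017:L61-L68, p0036:L26-L28)] -/
theorem hasseD_aeval_linSubst (M : σ → σ → K) (k : ℕ) (u : σ → K) (q : MvPolynomial σ K) :
    hasseD k u (aeval (fun v => ∑ w, C (M v w) * X w) q) =
      aeval (fun v => ∑ w, C (M v w) * X w) (hasseD k (fun v => ∑ w, M v w * u w) q) :=
  hasseD_aeval_affine _ M 0 (fun j => by rw [Pi.zero_apply, C_0, add_zero]) k u q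

/-- First-order instance: `∂(q ∘ M)/∂y_w = (Σ_v M_{v,w} ∂q/∂y_v) ∘ M`.
[cite: MediniShpilka2021, Lemma 3.8 (arXiv p0017:L61-L68)] -/
theorem pderiv_aeval_linSubst (M : σ → σ → K) (w : σ) (q : MvPolynomial σ K) :
    pderiv w (aeval (fun v => ∑ w', C (M v w') * X w') q) =
      aeval (fun v => ∑ w', C (M v w') * X w') (∑ v, C (M v w) * pderiv v q) := by
  have hdir : (fun v => ∑ w', M v w' * Pi.single (M := fun _ => K) w 1 w') = fun v => M v w := by
    funext v
    rw [Finset.sum_eq_single w (fun i _ hi => by rw [Pi.single_eq_of_ne hi, mul_zero])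
      (fun h => absurd (Finset.mem_univ w) h), Pi.single_eq_same, mul_one]
  rw [← hasseD_one_single, hasseD_aeval_linSubst, hdir, hasseD_one]

omit [DecidableEq σ] in
/-- Composition of two linear substitutions is the substitution by the product matrix
(`(f(Mx))(Nx) = f(MNx)`). [cite: MediniShpilka2021, §1.1.6 (arXiv p0007:L7-L18)] -/
theorem aeval_linSubst_comp (M N : Matrix σ σ K) :
    (aeval (fun v => ∑ w, C (N v w) * X w) : MvPolynomial σ K →ₐ[K] MvPolynomial σ K).comp
      (aeval fun v => ∑ w, C (M v w) * X w) =
      aeval fun v => ∑ w, C ((M * N) v w) * (X w : MvPolynomial σ K) := by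
  rw [comp_aeval]
  congr 1
  funext v
  rw [map_sum]
  simp_rw [map_mul, algHom_C, algebraMap_eq, aeval_X, Finset.mul_sum, ← mul_assoc, ← C_mul]
  rw [Finset.sum_comm]
  refine Finset.sum_congr rfl fun u _ => ?_
  rw [Matrix.mul_apply, map_sum, Finset.sum_mul]

/-- **`q ↦ q ∘ M` is injective for invertible `M`** (inverse substitution `M⁻¹`).
[cite: MediniShpilka2021, §1.1.6 (arXiv p0007:L7-L18)] -/
theorem aeval_linSubst_injective (M : Matrix σ σ K) (hM : IsUnit M.det) :
    Function.Injective
      (aeval (fun v => ∑ w, C (M v w) * X w) : MvPolynomial σ K →ₐ[K] MvPolynomial σ K) := by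
  intro p q hpq
  have key : (aeval (fun v => ∑ w, C (M⁻¹ v w) * X w) : MvPolynomial σ K →ₐ[K] MvPolynomial σ K).comp
      (aeval fun v => ∑ w, C (M v w) * X w) = AlgHom.id K _ := by
    rw [aeval_linSubst_comp, Matrix.mul_nonsing_inv M hM]
    refine MvPolynomial.algHom_ext fun v => ?_
    rw [aeval_X, AlgHom.id_apply, Finset.sum_eq_single v (fun w _ hw => by
        rw [Matrix.one_apply_ne (Ne.symm hw), C_0, zero_mul]) (fun h => absurd (Finset.mem_univ v) h),
      Matrix.one_apply_eq, C_1, one_mul]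
  have := congrArg (aeval (fun v => ∑ w, C (M⁻¹ v w) * X w) : MvPolynomial σ K →ₐ[K] _) hpq
  rwa [← AlgHom.comp_apply, ← AlgHom.comp_apply, key, AlgHom.id_apply, AlgHom.id_apply] at this

end LinSubst

/-! ### Hasse derivatives of the pair-indexed tensor `T' = Σ_a ∏_j y_{(a,j)}` -/

section Tensor

variable {K : Type*} [Field K] {s d : ℕ}

/-- **`Δ^k_v T'`**: "`Σ_a Σ_{|J| = k} (∏_{j∈J} v_{a,j}) ∏_{j ∉ J} y_{a,j}`" — every monomial is a row
product with exactly `k` variables removed (the shape of `∂^k T/∂u_1⋯∂u_k` in Lemma 6.2).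
[cite: MediniShpilka2021, Lemma 6.2 and its proof (arXiv p0035:L8-L30)] -/
theorem hasseD_sum_prod_X (k : ℕ) (v : Fin s × Fin d → K) :
    hasseD k v (∑ a : Fin s, ∏ j : Fin d, X (a, j) : MvPolynomial (Fin s × Fin d) K) =
      ∑ a : Fin s, ∑ J ∈ (Finset.univ : Finset (Fin d)).powersetCard k,
        C (∏ j ∈ J, v (a, j)) * ∏ j ∈ Finset.univ \ J, X (a, j) := by
  classical
  rw [hasseD_sum]
  exact Finset.sum_congr rfl fun a _ => hasseD_prod_X k v Finset.univ fun j => (a, j)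

/-- The exponent `Σ_{j∈S} e_{(a,j)}` evaluated. [cite: MediniShpilka2021, Def 40 (arXiv p0008:L51-L53)] -/
theorem sum_single_apply (a : Fin s) (S : Finset (Fin d)) (a' : Fin s) (j' : Fin d) :
    (∑ j ∈ S, Finsupp.single (a, j) 1 : Fin s × Fin d →₀ ℕ) (a', j') =
      if a' = a ∧ j' ∈ S then 1 else 0 := by
  classical
  rw [Finset.sum_apply']
  simp only [Finsupp.single_apply, Prod.mk.injEq]
  by_cases h : a = a'
  · subst h
    simp only [true_and]
    rw [Finset.sum_ite_eq']
  · have h' : ¬ a' = a := fun hh => h hh.symm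
    simp [h, h']

/-- Partial row exponents determine the row and the set (when the set is non-empty).
[cite: MediniShpilka2021, Def 40 ("variable-disjoint monomials"; arXiv p0008:L51-L53)] -/
theorem sum_single_inj {a a₀ : Fin s} {S S₀ : Finset (Fin d)} (hS₀ : S₀.Nonempty)
    (h : (∑ j ∈ S, Finsupp.single (a, j) 1 : Fin s × Fin d →₀ ℕ) = ∑ j ∈ S₀, Finsupp.single (a₀, j) 1) :
    a = a₀ ∧ S = S₀ := by
  obtain ⟨j₀, hj₀⟩ := hS₀
  have ha : a = a₀ := by
    have e := congrArg (fun m : Fin s × Fin d →₀ ℕ => m (a₀, j₀)) h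
    simp only [sum_single_apply, true_and, if_pos hj₀] at e
    by_contra hne
    rw [if_neg fun hh => hne hh.1.symm] at e
    exact zero_ne_one e
  subst ha
  refine ⟨rfl, Finset.ext fun j => ?_⟩
  have e := congrArg (fun m : Fin s × Fin d →₀ ℕ => m (a, j)) h
  simp only [sum_single_apply, true_and] at e
  by_cases h1 : j ∈ S <;> by_cases h2 : j ∈ S₀ <;> simp_all

/-- A partial row product is a monomial. [cite: MediniShpilka2021, Def 40 (arXiv p0008:L51-L53)] -/
theorem prod_X_eq_monomial_pair (a : Fin s) (S : Finset (Fin d)) :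
    (∏ j ∈ S, X (a, j) : MvPolynomial (Fin s × Fin d) K) =
      monomial (∑ j ∈ S, Finsupp.single (a, j) 1) 1 := by
  rw [monomial_sum_index, C_1, one_mul]
  rfl

/-- **Coefficient extraction**: for `|J₀| = k < d`, the coefficient of `∏_{j∉J₀} y_{a₀,j}` in
`Δ^k_v T'` is `∏_{j∈J₀} v_{a₀,j}`. [cite: MediniShpilka2021, Lemma 6.2 (arXiv p0035:L8-L30)] -/
theorem coeff_hasseD_sum_prod_X (k : ℕ) (v : Fin s × Fin d → K) (a₀ : Fin s) (J₀ : Finset (Fin d))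
    (hJ₀ : J₀.card = k) (hne : (Finset.univ \ J₀).Nonempty) :
    coeff (∑ j ∈ Finset.univ \ J₀, Finsupp.single (a₀, j) 1)
      (hasseD k v (∑ a : Fin s, ∏ j : Fin d, X (a, j) : MvPolynomial (Fin s × Fin d) K)) =
      ∏ j ∈ J₀, v (a₀, j) := by
  classical
  rw [hasseD_sum_prod_X, coeff_sum]
  simp_rw [coeff_sum, prod_X_eq_monomial_pair, coeff_C_mul, coeff_monomial]
  have hJ₀mem : J₀ ∈ (Finset.univ : Finset (Fin d)).powersetCard k :=
    Finset.mem_powersetCard.2 ⟨Finset.subset_univ _, hJ₀⟩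
  rw [Finset.sum_eq_single a₀]
  · rw [Finset.sum_eq_single J₀]
    · rw [if_pos rfl, mul_one]
    · intro J _ hJ
      rw [if_neg, mul_zero]
      intro heq
      have := (sum_single_inj hne heq).2
      apply hJ
      have e2 := congrArg (fun S => (Finset.univ : Finset (Fin d)) \ S) this
      simpa only [sdiff_sdiff_right_self, Finset.inf_eq_inter, Finset.univ_inter] using e2
    · intro h
      exact absurd hJ₀mem h
  · intro a _ ha
    refine Finset.sum_eq_zero fun J _ => ?_
    rw [if_neg, mul_zero]
    intro heq
    exact ha (sum_single_inj hne heq).1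
  · intro h
    exact absurd (Finset.mem_univ a₀) h

/-- **`Δ²_{e_w} T' = 0`**: the tensor is multilinear (the Hasse version of "`∂²T/∂x_v² = 0`", valid
in every characteristic). [cite: MediniShpilka2021, proof of Thm 45 (arXiv p0036:L38-L40)] -/
theorem hasseD_two_single_sum_prod_X (w : Fin s × Fin d) :
    hasseD 2 (Pi.single w 1) (∑ a : Fin s, ∏ j : Fin d, X (a, j) : MvPolynomial (Fin s × Fin d) K) =
      0 := by
  classical
  rw [hasseD_sum_prod_X]
  refine Finset.sum_eq_zero fun a _ => Finset.sum_eq_zero fun J hJ => ?_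
  obtain ⟨j₁, j₂, hne, rfl⟩ := Finset.card_eq_two.1 (Finset.mem_powersetCard.1 hJ).2
  rw [Finset.prod_pair hne]
  by_cases h1 : (a, j₁) = w
  · have h2 : (a, j₂) ≠ w := fun h2 => hne (by
      have := h1.trans h2.symm
      simpa using this)
    rw [Pi.single_eq_of_ne h2, mul_zero, C_0, zero_mul]
  · rw [Pi.single_eq_of_ne h1, zero_mul, C_0, zero_mul]

end Tensor

/-! ### The structure lemma: no second-order Hasse witness ⇒ `M` is block-monomial -/

section Structure

variable {K : Type*} [Field K] {s d : ℕ}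

/-- **Structure lemma** (the new ingredient closing the characteristic-`p` residue of the printed
Case B, `d ≥ 3`). Let `M` be invertible and `P = T' ∘ M` (`T' = Σ_a ∏_j y_{a,j}`). If every slot
Hasse derivative `Δ²_{e_w} P` vanishes and every mixed derivative `∂_w ∂_{w'} P` vanishes whenever
`∂_w ∂_{w'} T'` does, then all `{ℓ_1}`-monomials of `P` are row monomials of `T'` (the printed Case A).
Mechanism: `Δ²_{e_w} P = (Δ²_{M e_w} T') ∘ M` and `Δ²_v T' = Σ_a Σ_{j<j'} v_{aj} v_{aj'} ∏_{j''≠j,j'} y`,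
so the hypotheses say `M_{aj,w} M_{aj',w} = 0` and (by polarisation)
`M_{aj,w} M_{aj',w'} + M_{aj',w} M_{aj,w'} = 0` across blocks; hence the `d` rows `(a,·)` of `M` have
pairwise disjoint singleton supports inside one column block, i.e. `M` is block-monomial.
(Not in the source, whose sub-case "`a_{i,j} ≥ 2`" divides by `a(a-1)`; this replaces it.)
[cite: MediniShpilka2021, proof of Thm 45, Cases A/B (arXiv p0036:L29-L50)] -/
theorem rowSupported_of_forall_hasseD_eq_zero (hd : 3 ≤ d)
    (M : Matrix (Fin s × Fin d) (Fin s × Fin d) K) (hM : IsUnit M.det)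
    (h2 : ∀ w, hasseD 2 (Pi.single w 1)
      (aeval (fun v => ∑ w', C (M v w') * X w')
        (∑ a : Fin s, ∏ j : Fin d, X (a, j) : MvPolynomial (Fin s × Fin d) K)) = 0)
    (h11 : ∀ w w', pderiv w (pderiv w'
        (∑ a : Fin s, ∏ j : Fin d, X (a, j) : MvPolynomial (Fin s × Fin d) K)) = 0 →
      pderiv w (pderiv w' (aeval (fun v => ∑ w', C (M v w') * X w')
        (∑ a : Fin s, ∏ j : Fin d, X (a, j) : MvPolynomial (Fin s × Fin d) K))) = 0) :
    ∀ α ∈ (aeval (fun v => ∑ w', C (M v w') * X w')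
        (∑ a : Fin s, ∏ j : Fin d, X (a, j) : MvPolynomial (Fin s × Fin d) K)).support,
      ∃ a : Fin s, α = ∑ j : Fin d, Finsupp.single (a, j) 1 := by
  classical
  set T : MvPolynomial (Fin s × Fin d) K := ∑ a : Fin s, ∏ j : Fin d, X (a, j) with hT
  have hinj := aeval_linSubst_injective M hM
  -- Step A: `Δ²_{col_w M} T' = 0`
  have hA : ∀ w, hasseD 2 (fun v => M v w) T = 0 := by
    intro w
    have e := h2 w
    rw [hasseD_aeval_linSubst] at e
    have hdir : (fun v => ∑ w', M v w' * Pi.single (M := fun _ => K) w 1 w') = fun v => M v w := by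
      funext v
      rw [Finset.sum_eq_single w (fun i _ hi => by rw [Pi.single_eq_of_ne hi, mul_zero])
        (fun h => absurd (Finset.mem_univ w) h), Pi.single_eq_same, mul_one]
    rw [hdir] at e
    exact hinj (by rw [e, map_zero])
  -- Step B: `Δ²_{col_w + col_w'} T' = 0` for `w`, `w'` in different blocks
  have hB : ∀ w w' : Fin s × Fin d, w.1 ≠ w'.1 →
      hasseD 2 ((fun v => M v w) + fun v => M v w') T = 0 := by
    intro w w' hww'
    have hP : hasseD 2 (Pi.single w 1 + Pi.single w' 1) (aeval (fun v => ∑ w', C (M v w') * X w') T) =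
        0 := by
      rw [hasseD_two_add, h2, h2, zero_add, zero_add,
        Finset.sum_eq_single w (fun a _ ha => Finset.sum_eq_zero fun b _ => by
          rw [Pi.single_eq_of_ne ha, zero_mul, C_0, zero_mul]) (fun h => absurd (Finset.mem_univ w) h),
        Finset.sum_eq_single w' (fun b _ hb => by
          rw [Pi.single_eq_of_ne hb, mul_zero, C_0, zero_mul]) (fun h => absurd (Finset.mem_univ w') h),
        Pi.single_eq_same, Pi.single_eq_same, mul_one, C_1, one_mul]
      exact h11 w w' (pderiv_pderiv_sum_prod_X w w' (Or.inr hww'))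
    rw [hasseD_aeval_linSubst] at hP
    have hdir : (fun v => ∑ w'', M v w'' * (Pi.single w 1 + Pi.single w' 1 : Fin s × Fin d → K) w'') =
        (fun v => M v w) + fun v => M v w' := by
      funext v
      simp only [Pi.add_apply, mul_add, Finset.sum_add_distrib]
      rw [Finset.sum_eq_single w (fun i _ hi => by rw [Pi.single_eq_of_ne hi, mul_zero])
        (fun h => absurd (Finset.mem_univ w) h), Pi.single_eq_same, mul_one,
        Finset.sum_eq_single w' (fun i _ hi => by rw [Pi.single_eq_of_ne hi, mul_zero])
        (fun h => absurd (Finset.mem_univ w') h), Pi.single_eq_same, mul_one]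
    rw [hdir] at hP
    exact hinj (by rw [hP, map_zero])
  -- Step C: the conditions on the entries of `M`
  have hne : ∀ j₁ j₂ : Fin d, j₁ ≠ j₂ → ((Finset.univ : Finset (Fin d)) \ {j₁, j₂}).Nonempty := by
    intro j₁ j₂ hj
    rw [← Finset.card_pos, Finset.card_sdiff_of_subset (Finset.subset_univ _), Finset.card_univ,
      Fintype.card_fin, Finset.card_pair hj]
    omega
  have hCa : ∀ (a : Fin s) (j₁ j₂ : Fin d), j₁ ≠ j₂ → ∀ w, M (a, j₁) w * M (a, j₂) w = 0 := by
    intro a j₁ j₂ hj w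
    have e := coeff_hasseD_sum_prod_X 2 (fun v => M v w) a {j₁, j₂} (Finset.card_pair hj) (hne j₁ j₂ hj)
    rw [hA w, coeff_zero, Finset.prod_pair hj] at e
    exact e.symm
  have hCb : ∀ (a : Fin s) (j₁ j₂ : Fin d), j₁ ≠ j₂ → ∀ w w' : Fin s × Fin d, w.1 ≠ w'.1 →
      M (a, j₁) w * M (a, j₂) w' + M (a, j₂) w * M (a, j₁) w' = 0 := by
    intro a j₁ j₂ hj w w' hww'
    have e := coeff_hasseD_sum_prod_X 2 ((fun v => M v w) + fun v => M v w') a {j₁, j₂}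
      (Finset.card_pair hj) (hne j₁ j₂ hj)
    rw [hB w w' hww', coeff_zero, Finset.prod_pair hj] at e
    simp only [Pi.add_apply] at e
    have e1 := hCa a j₁ j₂ hj w
    have e2 := hCa a j₁ j₂ hj w'
    linear_combination -e - e1 - e2
  -- Step D: combinatorics — rows are nonzero, supports lie in one block, and are singletons
  have hrow : ∀ v : Fin s × Fin d, ∃ w, M v w ≠ 0 := by
    intro v
    by_contra hno
    push Not at hno
    exact hM.ne_zero (Matrix.det_eq_zero_of_row_eq_zero v hno)
  choose π hπ using hrow
  have hd2 : 2 ≤ d := by omega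
  -- D1: two nonzero entries in rows of the same block lie in the same column block
  have hD1 : ∀ (a : Fin s) (j₁ j₂ : Fin d) (w w' : Fin s × Fin d),
      M (a, j₁) w ≠ 0 → M (a, j₂) w' ≠ 0 → w.1 = w'.1 := by
    have hdist : ∀ (a : Fin s) (j₁ j₂ : Fin d), j₁ ≠ j₂ → ∀ w w' : Fin s × Fin d,
        M (a, j₁) w ≠ 0 → M (a, j₂) w' ≠ 0 → w.1 = w'.1 := by
      intro a j₁ j₂ hj w w' h1 h2'
      by_contra hww'
      have e := hCb a j₁ j₂ hj w w' hww'
      have e0 : M (a, j₁) w * M (a, j₂) w = 0 := hCa a j₁ j₂ hj w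
      have hw2 : M (a, j₂) w = 0 := by
        rcases mul_eq_zero.1 e0 with h | h
        · exact absurd h h1
        · exact h
      rw [hw2, zero_mul, add_zero] at e
      rcases mul_eq_zero.1 e with h | h
      · exact h1 h
      · exact h2' h
    intro a j₁ j₂ w w' h1 h2'
    by_cases hj : j₁ = j₂
    · subst hj
      -- use a third row `j₃ ≠ j₁`
      obtain ⟨j₃, hj₃⟩ : ∃ j₃ : Fin d, j₃ ≠ j₁ := by
        by_contra hno
        push Not at hno
        have : Fintype.card (Fin d) ≤ 1 := Fintype.card_le_one_iff.2 fun x y => (hno x).trans (hno y).symm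
        rw [Fintype.card_fin] at this
        omega
      have e1 := hdist a j₁ j₃ (Ne.symm hj₃) w (π (a, j₃)) h1 (hπ _)
      have e2 := hdist a j₁ j₃ (Ne.symm hj₃) w' (π (a, j₃)) h2' (hπ _)
      rw [e1, e2]
    · exact hdist a j₁ j₂ hj w w' h1 h2'
  -- the column block `κ a` and the column index `φ (a, j)` of row `(a, j)`
  have hblock : ∀ (a : Fin s) (j : Fin d) (w : Fin s × Fin d), M (a, j) w ≠ 0 →
      w.1 = (π (a, ⟨0, by omega⟩)).1 := fun a j w h => hD1 a j _ w _ h (hπ _)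
  have hφinj : ∀ a : Fin s, Function.Injective fun j : Fin d => (π (a, j)).2 := by
    intro a j₁ j₂ h
    by_contra hj
    have hw : π (a, j₁) = π (a, j₂) := Prod.ext ((hblock a j₁ _ (hπ _)).trans
      (hblock a j₂ _ (hπ _)).symm) h
    have e := hCa a j₁ j₂ hj (π (a, j₁))
    rcases mul_eq_zero.1 e with h' | h'
    · exact hπ _ h'
    · rw [hw] at h'
      exact hπ _ h'
  have hφbij : ∀ a : Fin s, Function.Bijective fun j : Fin d => (π (a, j)).2 := fun a =>
    (hφinj a).bijective_of_finite
  -- uniqueness of the nonzero entry in each row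
  have huniq : ∀ (a : Fin s) (j : Fin d) (w : Fin s × Fin d), w ≠ π (a, j) → M (a, j) w = 0 := by
    intro a j w hw
    by_contra h
    obtain ⟨j', hj'⟩ := (hφbij a).2 w.2
    have hw1 := hblock a j w h
    by_cases hjj : j' = j
    · subst hjj
      exact hw (Prod.ext (hw1.trans (hblock a j' _ (hπ _)).symm) hj'.symm)
    · -- `M (a,j') (π (a,j')) ≠ 0` and `M (a,j) (π (a, j')) ≠ 0`, same column: contradicts (a)
      have hcol : π (a, j') = w := Prod.ext ((hblock a j' _ (hπ _)).trans hw1.symm) hj'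
      have e := hCa a j' j hjj w
      rw [← hcol] at e
      rcases mul_eq_zero.1 e with h' | h'
      · exact hπ _ h'
      · rw [hcol] at h'
        exact h h'
  -- Step E: `P = Σ_a c_a · (row monomial of block κ a)`
  have hlin : ∀ (a : Fin s) (j : Fin d),
      (∑ w', C (M (a, j) w') * X w' : MvPolynomial (Fin s × Fin d) K) =
        C (M (a, j) (π (a, j))) * X (π (a, j)) := by
    intro a j
    exact Finset.sum_eq_single (π (a, j)) (fun w _ hw => by rw [huniq a j w hw, C_0, zero_mul])
      fun h => absurd (Finset.mem_univ _) h
  have hP : aeval (fun v => ∑ w', C (M v w') * X w') T =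
      ∑ a : Fin s, monomial (∑ j : Fin d, Finsupp.single ((π (a, ⟨0, by omega⟩)).1, j) 1)
        (∏ j : Fin d, M (a, j) (π (a, j))) := by
    rw [hT, map_sum]
    refine Finset.sum_congr rfl fun a _ => ?_
    rw [map_prod]
    simp_rw [aeval_X]
    have hfac : ∀ j : Fin d, (∑ w', C (M (a, j) w') * X w' : MvPolynomial (Fin s × Fin d) K) =
        C (M (a, j) (π (a, j))) * X ((π (a, ⟨0, by omega⟩)).1, (π (a, j)).2) := by
      intro j
      rw [hlin]
      congr 2
      exact Prod.ext (hblock a j _ (hπ _)) rfl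
    simp_rw [hfac]
    rw [Finset.prod_mul_distrib, ← map_prod C,
      Fintype.prod_bijective _ (hφbij a) (fun x => X ((π (a, ⟨0, by omega⟩)).1, (π (a, x)).2))
        (fun i => (X ((π (a, ⟨0, by omega⟩)).1, i) : MvPolynomial (Fin s × Fin d) K)) (fun _ => rfl),
      prod_X_row_eq_monomial, C_mul_monomial, mul_one]
  intro α hα
  rw [hP] at hα
  obtain ⟨a, -, ha⟩ := Finset.mem_biUnion.1 (support_sum hα)
  exact ⟨(π (a, ⟨0, by omega⟩)).1, Finset.mem_singleton.1 (support_monomial_subset ha)⟩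

end Structure

/-! ### Transport to the orbit: dual directions, the engine, the equal-span case -/

section Orbit

variable {K : Type*} [Field K] {n s d : ℕ}

/-- `(-p)(Ax+b) = -p(Ax+b)`. [folklore] -/
private theorem affSubst_neg'' {m : ℕ} (h : m ≤ n) (A : Matrix (Fin n) (Fin n) K) (b : Fin n → K)
    (p : MvPolynomial (Fin m) K) : affSubst h A b (-p) = -affSubst h A b p := by
  unfold affSubst; exact map_neg _ _

/-- `(p-q)(Ax+b) = p(Ax+b) - q(Ax+b)`. [folklore] -/
private theorem affSubst_sub'' {m : ℕ} (h : m ≤ n) (A : Matrix (Fin n) (Fin n) K) (b : Fin n → K)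
    (p q : MvPolynomial (Fin m) K) : affSubst h A b (p - q) = affSubst h A b p - affSubst h A b q := by
  unfold affSubst; exact map_sub _ _ _

/-- `0(Ax+b) = 0`. [folklore] -/
private theorem affSubst_zero'' {m : ℕ} (h : m ≤ n) (A : Matrix (Fin n) (Fin n) K) (b : Fin n → K) :
    affSubst h A b (0 : MvPolynomial (Fin m) K) = 0 := by
  unfold affSubst; exact map_zero _

/-- **Hasse derivatives along DUAL directions** (the Hasse version of x6's `dualDeriv_affSubst_rename`,
Lemma 3.8 on pair indices): along the column `v_{w₀}` of `A⁻¹` the order-`k` Hasse derivative of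
`q(ℓ(x))` is `(Δ^k_{e_{w₀}} q)(ℓ(x))`. [cite: MediniShpilka2021, Lemma 3.8 (arXiv p0017:L61-L68)] -/
theorem dualHasseD_affSubst_rename (h : s * d ≤ n) {A : Matrix (Fin n) (Fin n) K} (hA : IsUnit A.det)
    (b : Fin n → K) (w₀ : Fin s × Fin d) (k : ℕ) (q : MvPolynomial (Fin s × Fin d) K) :
    hasseD k (fun j => A⁻¹ j (Fin.castLE h (finProdFinEquiv w₀)))
        (affSubst h A b (rename finProdFinEquiv q)) =
      affSubst h A b (rename finProdFinEquiv (hasseD k (Pi.single w₀ 1) q)) := by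
  classical
  unfold affSubst
  rw [hasseD_aeval_affine _ (fun i j => A (Fin.castLE h i) j) (fun i => b (Fin.castLE h i))
    (fun i => rfl) k, hasseD_rename]
  have hdir : ((fun i : Fin (s * d) => ∑ j, A (Fin.castLE h i) j * A⁻¹ j (Fin.castLE h (finProdFinEquiv w₀))) ∘
      finProdFinEquiv) = Pi.single w₀ 1 := by
    funext w
    rw [Function.comp_apply, ← Matrix.mul_apply, Matrix.mul_nonsing_inv A hA, Matrix.one_apply]
    by_cases hw : w = w₀
    · subst hw
      rw [if_pos rfl, Pi.single_eq_same]
    · rw [if_neg fun heq => hw (finProdFinEquiv.injective (Fin.castLE_injective h heq)),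
        Pi.single_eq_of_ne hw]
  rw [hdir]

/-- **The engine on a second Hasse derivative of the tensor** (Lemma 6.2 with `k = 2`): for
`R = Δ²_v T' ≠ 0` — a combination of row products with exactly two variables removed — every
`B`-independent map with `B ≥ 4` hits `R(Ax + b)` (seat t18 g5's `MS21DiagonalTensorDerivatives`).
[cite: MediniShpilka2021, Lemma 6.2 (arXiv p0035:L8-L30)] -/
theorem bind₁_affSubst_rename_hasseD_two_ne_zero (h : s * d ≤ n) (hd : 2 ≤ d)
    (v : Fin s × Fin d → K)
    (hR : hasseD 2 v (∑ a : Fin s, ∏ j : Fin d, X (a, j) : MvPolynomial (Fin s × Fin d) K) ≠ 0)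
    {A : Matrix (Fin n) (Fin n) K} (hA : IsUnit A.det) (b : Fin n → K) {B c : ℕ}
    (G : Fin n → MvPolynomial (Fin B × (Fin c ⊕ Unit)) K) (hG : IsIndependent B G) (hB : 4 ≤ B) :
    bind₁ G (affSubst h A b (rename finProdFinEquiv
      (hasseD 2 v (∑ a : Fin s, ∏ j : Fin d, X (a, j) : MvPolynomial (Fin s × Fin d) K)))) ≠ 0 := by
  classical
  refine DiagDeriv.bind₁_affSubst_ne_zero_of_blockSupport h (k := 2) _
    (fun h0 => hR (rename_injective _ finProdFinEquiv.injective (by rw [h0, map_zero]))) ?_ hA b G hG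
    (by omega)
  intro m hm
  rw [hasseD_sum_prod_X, map_sum] at hm
  simp only [map_sum, map_mul, rename_C,
    map_prod (rename finProdFinEquiv : MvPolynomial (Fin s × Fin d) K →ₐ[K] MvPolynomial (Fin (s * d)) K),
    rename_X, DiagDeriv.prod_X_eq_monomial, C_mul_monomial, mul_one] at hm
  obtain ⟨a, -, ha⟩ := Finset.mem_biUnion.1 (support_sum hm)
  obtain ⟨J, hJ, hJ'⟩ := Finset.mem_biUnion.1 (support_sum ha)
  refine ⟨a, Finset.univ \ J, ?_, Finset.mem_singleton.1 (support_monomial_subset hJ')⟩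
  rw [Finset.card_sdiff_of_subset (Finset.subset_univ _), Finset.card_univ, Fintype.card_fin,
    (Finset.mem_powersetCard.1 hJ).2]
  omega

/-- The change-of-basis matrix between two bases of the same span is invertible: if
`ℓ_{2,v} = Σ_w M_{v,w} ℓ_{1,w}` with both families linearly independent (rows of `A₂`, `A₁ ∈ GL_n`)
then `M ∈ GL`. [cite: MediniShpilka2021, proof of Thm 45 (arXiv p0036:L16-L28)] -/
theorem isUnit_det_of_rows_eq (h : s * d ≤ n) {A₁ A₂ : Matrix (Fin n) (Fin n) K}
    (hA₂ : IsUnit A₂.det) (M : Matrix (Fin s × Fin d) (Fin s × Fin d) K)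
    (hM : ∀ v k, A₂ (Fin.castLE h (finProdFinEquiv v)) k =
      ∑ w, M v w * A₁ (Fin.castLE h (finProdFinEquiv w)) k) :
    IsUnit M.det := by
  classical
  rw [← Matrix.isUnit_iff_isUnit_det, ← Matrix.linearIndependent_rows_iff_isUnit]
  have hL₂ : LinearIndependent K
      (fun v : Fin s × Fin d => fun k => A₂ (Fin.castLE h (finProdFinEquiv v)) k) :=
    (linearIndependent_rows_castLE h hA₂).comp _ finProdFinEquiv.injective
  rw [Fintype.linearIndependent_iff] at hL₂ ⊢
  intro g hg v
  refine hL₂ g ?_ v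
  have hrow : ∀ w : Fin s × Fin d, (∑ v, g v • M.row v) w = 0 := fun w => by rw [hg]; rfl
  funext k
  rw [Finset.sum_apply, Pi.zero_apply]
  simp_rw [Pi.smul_apply, smul_eq_mul, hM, Finset.mul_sum, ← mul_assoc]
  rw [Finset.sum_comm]
  refine Finset.sum_eq_zero fun w _ => ?_
  rw [← Finset.sum_mul]
  have e := hrow w
  rw [Finset.sum_apply] at e
  simp_rw [Pi.smul_apply, smul_eq_mul, Matrix.row] at e
  rw [e, zero_mul]

/-- **Thm 45, the EQUAL-SPAN case, over every field** (`d ≥ 2`): "we can represent `f₂` as a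
polynomial in `{ℓ_{1,i,j}}` … two cases, depending on the `{ℓ_1}`-monomials appearing in `f₂`"
(p0036:L26-L50) — with `M` the (invertible) change of basis `ℓ_2 = M ℓ_1`. Case A (row monomials
only) is the printed one; in Case B the printed second-order DUAL DERIVATIVES are replaced by
second-order HASSE operators, of which a separating one always exists by the structure lemma
`rowSupported_of_forall_hasseD_eq_zero` (`d ≥ 3`; for `d ≤ 6` the degree-`d` form `f ≠ 0` is hit by
the support lemma directly). No characteristic hypothesis.
[cite: MediniShpilka2021, proof of Thm 45 (arXiv p0036:L26-L50)] -/
theorem bind₁_sub_ne_zero_of_rows_eq {c : ℕ} (hd : 2 ≤ d) (h : s * d ≤ n)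
    {A₁ A₂ : Matrix (Fin n) (Fin n) K} (hA₁ : IsUnit A₁.det) (hA₂ : IsUnit A₂.det)
    (M : Matrix (Fin s × Fin d) (Fin s × Fin d) K)
    (hM : ∀ v k, A₂ (Fin.castLE h (finProdFinEquiv v)) k =
      ∑ w, M v w * A₁ (Fin.castLE h (finProdFinEquiv w)) k)
    (hne : affSubst h A₁ 0 (rename finProdFinEquiv (∑ a : Fin s, ∏ j : Fin d, X (a, j))) -
      affSubst h A₂ 0 (rename finProdFinEquiv (∑ a : Fin s, ∏ j : Fin d, X (a, j))) ≠ 0)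
    {G : Fin n → MvPolynomial (Fin 6 × (Fin c ⊕ Unit)) K} (hG : IsIndependent 6 G) :
    bind₁ G (affSubst h A₁ 0 (rename finProdFinEquiv (∑ a : Fin s, ∏ j : Fin d, X (a, j))) -
      affSubst h A₂ 0 (rename finProdFinEquiv (∑ a : Fin s, ∏ j : Fin d, X (a, j)))) ≠ 0 := by
  classical
  have hd0 : 0 < d := by omega
  -- small degree: `f` is a nonzero form of degree `d ≤ 6`, hit by the support lemma
  by_cases hd6 : d ≤ 6
  · have hhom : (affSubst h A₁ 0 (rename finProdFinEquiv (∑ a : Fin s, ∏ j : Fin d, X (a, j))) -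
        affSubst h A₂ 0 (rename finProdFinEquiv (∑ a : Fin s, ∏ j : Fin d, X (a, j)))).IsHomogeneous d :=
      (isHomogeneous_affSubst_zero h A₁ isHomogeneous_sum_prod_X.rename_isHomogeneous).sub
        (isHomogeneous_affSubst_zero h A₂ isHomogeneous_sum_prod_X.rename_isHomogeneous)
    exact hG.bind₁_ne_zero_of_totalDegree_le hne (hhom.totalDegree_le.trans hd6)
  have hd3 : 3 ≤ d := by omega
  -- `f₂ = P(ℓ_1)` with `P = T' ∘ M`
  obtain ⟨P, hP⟩ : ∃ P : MvPolynomial (Fin s × Fin d) K,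
      aeval (fun v : Fin s × Fin d => ∑ w : Fin s × Fin d, (C (M v w) * X w :
        MvPolynomial (Fin s × Fin d) K))
        (∑ a : Fin s, ∏ j : Fin d, X (a, j) : MvPolynomial (Fin s × Fin d) K) = P := ⟨_, rfl⟩
  have hf₂ : affSubst h A₂ 0 (rename finProdFinEquiv (∑ a : Fin s, ∏ j : Fin d, X (a, j))) =
      affSubst h A₁ 0 (rename finProdFinEquiv P) := by
    rw [← hP]
    exact affSubst_rename_eq_of_rows_eq h h A₁ A₂ M hM _
  have hf₂orb : affSubst h A₁ 0 (rename finProdFinEquiv P) ∈ affOrbit n (sdm K s d) :=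
    ⟨h, A₂, 0, hA₂, by rw [← hf₂, sdm_eq_rename]⟩
  have hf : affSubst h A₁ 0 (rename finProdFinEquiv (∑ a : Fin s, ∏ j : Fin d, X (a, j))) -
      affSubst h A₂ 0 (rename finProdFinEquiv (∑ a : Fin s, ∏ j : Fin d, X (a, j))) =
      affSubst h A₁ 0 (rename finProdFinEquiv ((∑ a : Fin s, ∏ j : Fin d, X (a, j)) - P)) := by
    rw [hf₂, map_sub, affSubst_sub'']
  rw [hf] at hne ⊢
  have hQ0 : (∑ a : Fin s, ∏ j : Fin d, X (a, j) : MvPolynomial (Fin s × Fin d) K) - P ≠ 0 := by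
    intro h0
    exact hne (by rw [h0, map_zero, affSubst_zero''])
  by_cases hA : ∀ α ∈ P.support, ∃ a : Fin s, α = ∑ j : Fin d, Finsupp.single (a, j) 1
  · /- Case A (printed, p0036:L29-L31; x6 g3's argument verbatim): `Q = T' - P` is a nonzero
    combination of row monomials; differentiate once along the dual vector of `x_{(a₀,0)}`. -/
    have hQ : ∀ α ∈ ((∑ a : Fin s, ∏ j : Fin d, X (a, j) : MvPolynomial (Fin s × Fin d) K) -
        P).support, ∃ a : Fin s, α = ∑ j : Fin d, Finsupp.single (a, j) 1 := by
      intro α hα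
      rcases Finset.mem_union.1 (support_sub _ _ _ hα) with hT | hP'
      · have hc := mem_support_iff.1 hT
        rw [coeff_sum_prod_X hd0] at hc
        by_contra hno
        exact hc (if_neg hno)
      · exact hA α hP'
    obtain ⟨α₀, hα₀⟩ := ne_zero_iff.1 hQ0
    obtain ⟨a₀, rfl⟩ := hQ α₀ (mem_support_iff.2 hα₀)
    refine bind₁_ne_zero_of_forall_dirDeriv hG _
      (fun j => A₁⁻¹ j (Fin.castLE h (finProdFinEquiv (a₀, (⟨0, hd0⟩ : Fin d))))) fun G' hG' => ?_
    rw [dualDeriv_affSubst_rename h hA₁, pderiv_eq_C_mul_prod_of_rows _ hQ a₀ ⟨0, hd0⟩]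
    simp only [affSubst, map_mul, map_prod, rename_X, algHom_C, algebraMap_eq, aeval_X]
    refine mul_ne_zero (C_ne_zero.2 hα₀) (Finset.prod_ne_zero_iff.2 fun j _ => ?_)
    obtain ⟨k₀, hk₀⟩ :=
      exists_apply_ne_zero_of_isUnit_det hA₁ (Fin.castLE h (finProdFinEquiv (a₀, j)))
    exact hG'.bind₁_affine_ne_zero (by norm_num) _ _ ⟨k₀, hk₀⟩
  · /- Case B (a non-row `{ℓ_1}`-monomial in `f₂`), characteristic-free: by the structure lemma a
    separating second-order operator exists — a slot Hasse derivative `Δ²_{e_w}` or a mixed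
    derivative `∂_{v₀}∂_{v₁}` killing `T'`; two peeled blocks and the engine with `k = 2` finish. -/
    have hMunit : IsUnit M.det := isUnit_det_of_rows_eq h hA₂ M hM
    have hsep : (∃ w, hasseD 2 (Pi.single w 1) P ≠ 0) ∨
        ∃ v₀ v₁ : Fin s × Fin d, pderiv v₀ (pderiv v₁ (∑ a : Fin s, ∏ j : Fin d, X (a, j) :
          MvPolynomial (Fin s × Fin d) K)) = 0 ∧ pderiv v₀ (pderiv v₁ P) ≠ 0 := by
      by_contra hno
      push Not at hno
      obtain ⟨h2, h11⟩ := hno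
      apply hA
      rw [← hP] at h2 h11 ⊢
      exact rowSupported_of_forall_hasseD_eq_zero hd3 M hMunit h2 (fun w w' hT => h11 w w' hT)
    rcases hsep with ⟨w, hw⟩ | ⟨v₀, v₁, hT0, hP0⟩
    · -- the Hasse branch: `Δ²_{u_w} f = -(Δ²_{e_w} P)(ℓ_1) = -(Δ²_{M e_w} T')(ℓ_2)`
      refine bind₁_ne_zero_of_forall_hasseD_two hG _
        (fun j => A₁⁻¹ j (Fin.castLE h (finProdFinEquiv w))) fun G'' hG'' => ?_
      rw [dualHasseD_affSubst_rename h hA₁, hasseD_sub, hasseD_two_single_sum_prod_X, zero_sub,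
        map_neg, affSubst_neg'', map_neg, neg_ne_zero]
      have hdir : (fun v => ∑ w', M v w' * Pi.single (M := fun _ => K) w 1 w') = fun v => M v w := by
        funext v
        rw [Finset.sum_eq_single w (fun i _ hi => by rw [Pi.single_eq_of_ne hi, mul_zero])
          (fun h => absurd (Finset.mem_univ w) h), Pi.single_eq_same, mul_one]
      have hR : hasseD 2 (Pi.single w 1) P = aeval (fun v => ∑ w', C (M v w') * X w')
          (hasseD 2 (fun v => M v w) (∑ a : Fin s, ∏ j : Fin d, X (a, j))) := by
        rw [← hP, hasseD_aeval_linSubst, hdir]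
      have hR0 : hasseD 2 (fun v => M v w)
          (∑ a : Fin s, ∏ j : Fin d, X (a, j) : MvPolynomial (Fin s × Fin d) K) ≠ 0 := by
        intro h0
        exact hw (by rw [hR, h0, map_zero])
      rw [hR, ← affSubst_rename_eq_of_rows_eq h h A₁ A₂ M hM]
      exact bind₁_affSubst_rename_hasseD_two_ne_zero h hd _ hR0 hA₂ 0 G'' hG'' le_rfl
    · -- the mixed branch (printed, p0036:L44-L50; x6 g3's argument verbatim)
      have hDD : ∀ q : MvPolynomial (Fin s × Fin d) K,
          (∑ j, C (A₁⁻¹ j (Fin.castLE h (finProdFinEquiv v₀))) * pderiv j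
            (∑ j', C (A₁⁻¹ j' (Fin.castLE h (finProdFinEquiv v₁))) * pderiv j'
              (affSubst h A₁ 0 (rename finProdFinEquiv q)))) =
            affSubst h A₁ 0 (rename finProdFinEquiv (pderiv v₀ (pderiv v₁ q))) := by
        intro q
        rw [dualDeriv_affSubst_rename h hA₁, dualDeriv_affSubst_rename h hA₁]
      refine bind₁_ne_zero_of_forall_dirDeriv_dirDeriv hG _
        (fun j => A₁⁻¹ j (Fin.castLE h (finProdFinEquiv v₀)))
        (fun j => A₁⁻¹ j (Fin.castLE h (finProdFinEquiv v₁))) fun G'' hG'' => ?_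
      have hkey : (∑ j, C (A₁⁻¹ j (Fin.castLE h (finProdFinEquiv v₀))) * pderiv j
          (∑ j', C (A₁⁻¹ j' (Fin.castLE h (finProdFinEquiv v₁))) * pderiv j'
            (affSubst h A₁ 0 (rename finProdFinEquiv
              ((∑ a : Fin s, ∏ j : Fin d, X (a, j)) - P))))) =
          -(∑ j, C (A₁⁻¹ j (Fin.castLE h (finProdFinEquiv v₀))) * pderiv j
            (∑ j', C (A₁⁻¹ j' (Fin.castLE h (finProdFinEquiv v₁))) * pderiv j'
              (affSubst h A₁ 0 (rename finProdFinEquiv P)))) := by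
        rw [hDD, hDD, map_sub, map_sub, hT0, zero_sub, map_neg, affSubst_neg'']
      have hne2 : (∑ j, C (A₁⁻¹ j (Fin.castLE h (finProdFinEquiv v₀))) * pderiv j
          (∑ j', C (A₁⁻¹ j' (Fin.castLE h (finProdFinEquiv v₁))) * pderiv j'
            (affSubst h A₁ 0 (rename finProdFinEquiv P)))) ≠ 0 := by
        rw [hDD]
        intro h0
        have h0' := eq_zero_of_affSubst_eq_zero h hA₁ 0 h0
        rw [map_eq_zero_iff _ (rename_injective _ finProdFinEquiv.injective)] at h0'
        exact hP0 h0'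
      rw [hkey, map_neg, neg_ne_zero]
      exact bind₁_dirDeriv_dirDeriv_ne_zero_of_mem_affOrbit_sdm hf₂orb _ _ hne2 hG'' le_rfl

end Orbit

end MS2021

end Literature.Computability.AlgebraicComplexity
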